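import Literature.AlgebraicGeometry.Limits.FiniteTypeModel
import Literature.AlgebraicGeometry.Limits.ClosedSubschemes
import Literature.AlgebraicGeometry.Limits.SubalgebraDiagram
import Literature.AlgebraicGeometry.Morphisms.ReducedOfFlat
import Mathlib.AlgebraicGeometry.Morphisms.ClosedImmersion
import Mathlib.CategoryTheory.Limits.Shapes.Pullback.Pasting

/-!
# `Descent.DescentPerfectToAll`, line `arc-special-fibre-transversality`: finitely generated models

Route `ResolutionOfSingularities/Descent`, crux `DescentPerfectToAll`
(stmt-ResolutionOfSingularities-0549), stub `stub_fgModel` of the lead's skeleton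
`work/DescentPerfectToAll.lean`, PROVED here (statement verbatim from the ledger registration).

**Statement (spreading out, EGA IV₃ 8.8.2 / Stacks 01ZM).** Let `k` be a field and `f : X → Spec k`
separated, locally of finite type and quasi-compact, with `X` reduced. Then there are a finite
`s ⊆ k`, the subfield `K₀ = closure s ⊆ k` it generates, and a separated quasi-compact
`f₀ : X₀ → Spec K₀` locally of finite type with `X₀` reduced and `X ≅ X₀ ×_{K₀} Spec k`.

**Proof.**
1. `Literature.AlgebraicGeometry.Limits.exists_finiteTypeModel`: a closed immersion
   `j : X ↪ Y₀ ×_{A₀} Spec k` over `k` into the base change of a separated finite type `Y₀ → Spec A₀`,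
   `A₀ ⊆ k` a finitely generated subring.
2. `Y₀ ×_{A₀} Spec k = lim_t Y₀ ×_{A₀} Spec A₀[t]` over the finite subsets `t ⊆ k`
   (`SubalgApprox.isLimitProdCone`); the limit is locally Noetherian (finite type over `k`), so the
   closed subscheme `X` is the base change of its scheme-theoretic image `X_t ↪ Y₀ ×_{A₀} Spec A₀[t]`
   for some `t` (`exists_isPullback_toImage_of_isLocallyNoetherian`, Görtz–Wedhorn I, Prop. 10.75);
   pasting with the base-change square of the leg (`SubalgApprox.isPullback_whiskerLeft_left`) gives
   `X = X_t ×_{A₀[t]} Spec k`.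
3. With `s = φ(G) ∪ t` (`G` a finite generating set of `A₀` over `ℤ`) the subfield `K₀ = closure s`
   contains `A₀[t]`; put `X₀ = X_t ×_{A₀[t]} Spec K₀`. Pasting pullbacks, `X = X₀ ×_{K₀} Spec k`.
4. `X₀ → Spec K₀` is separated, locally of finite type and quasi-compact (base change of a closed
   immersion followed by a base change of `Y₀ → Spec A₀`); `X → X₀` is flat and surjective (base
   change of `Spec k → Spec K₀`), so `X₀` is reduced (`isReduced_of_flat_of_surjective`).
-/

noncomputable section

set_option linter.dupNamespace false -- mandated namespace of this single-conjunct summit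

namespace Summit.ResolutionOfSingularities.ResolutionOfSingularities.Theorems

open CategoryTheory CategoryTheory.Limits AlgebraicGeometry MonoidalCategory Opposite
open Literature.AlgebraicGeometry.Limits Literature.AlgebraicGeometry.Morphisms
open Literature.AlgebraicGeometry.Motives (SchemeOver specOver)

-- As in `Literature/AlgebraicGeometry/Limits/SubalgebraDiagram.lean` and `ClosedSubschemes.lean`: the
-- cone legs `c.π.app i` have source `((Functor.const _).obj c.pt).obj i`, definitionally `c.pt`.
set_option backward.isDefEq.respectTransparency false

/-- SPREADING OUT: every reduced separated `k`-scheme of finite type is the base change of a reduced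
separated scheme of finite type over a finitely generated subfield `K₀ = closure s ⊆ k`.
[cite: EGAIV3, Thm. 8.8.2] -/
theorem stub_fgModel : ∀ (k : Type) [Field k] (X : Scheme.{0}) (f : X ⟶ Spec (.of k)), IsSeparated f → LocallyOfFiniteType f → QuasiCompact f → IsReduced X → ∃ (K₀ : Subfield k) (s : Finset k), K₀ = Subfield.closure (↑s : Set k) ∧ ∃ (X₀ : Scheme.{0}) (f₀ : X₀ ⟶ Spec (.of K₀)), IsSeparated f₀ ∧ LocallyOfFiniteType f₀ ∧ QuasiCompact f₀ ∧ IsReduced X₀ ∧ Nonempty (X ≅ pullback f₀ (Spec.map (CommRingCat.ofHom K₀.subtype))) := by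
  intro k _ X f hsep hlft hqc hred
  classical
  -- ### Step 1: a closed `k`-immersion into a finite type model over a finitely generated subring
  obtain ⟨A₀, _, φ, Y₀, p, j, hNoeth, hfgA, -, hpsep, hplft, hpqc, hj, hjf⟩ :=
    exists_finiteTypeModel f
  letI : Algebra A₀ k := φ.toAlgebra
  haveI := hNoeth
  let P : SchemeOver A₀ := Over.mk p
  haveI : IsSeparated P.hom := hpsep
  haveI : QuasiCompact P.hom := hpqc
  haveI : LocallyOfFiniteType P.hom := hplft
  let jY : X ⟶ (P ⊗ specOver A₀ k).left := j
  haveI : IsClosedImmersion jY := hj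
  have hg : jY ≫ pullback.snd P.hom (specOver A₀ k).hom = f := hjf
  -- ### Step 2: the closed subscheme `X` descends to a stage `A₀[t] ⊆ k`
  haveI : IsLocallyNoetherian (SubalgApprox.prodCone A₀ k ∅ P).pt := by
    haveI : IsLocallyNoetherian (specOver A₀ k).left :=
      inferInstanceAs (IsLocallyNoetherian (Spec (.of k)))
    change IsLocallyNoetherian (pullback P.hom (specOver A₀ k).hom)
    exact LocallyOfFiniteType.isLocallyNoetherian (pullback.snd P.hom (specOver A₀ k).hom)
  obtain ⟨i, hi⟩ := exists_isPullback_toImage_of_isLocallyNoetherian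
    (SubalgApprox.prodDiagram A₀ k ∅ P) (SubalgApprox.prodCone A₀ k ∅ P)
    (SubalgApprox.isLimitProdCone A₀ k ∅ P) jY
  have HX := hi i (𝟙 i)
  let R : Subalgebra A₀ k := SubalgApprox.sub A₀ k i.unop.1
  let π : (P ⊗ specOver A₀ k).left ⟶ (SubalgApprox.prodDiagram A₀ k ∅ P).obj i :=
    (SubalgApprox.prodCone A₀ k ∅ P).π.app i
  have Hleg : IsPullback π (pullback.snd P.hom (specOver A₀ k).hom)
      (pullback.snd P.hom (specOver A₀ R).hom)
      (Spec.map (CommRingCat.ofHom R.val.toRingHom)) :=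
    SubalgApprox.isPullback_whiskerLeft_left P ((SubalgApprox.baseCone A₀ k ∅).π.app i)
  let Xt : Scheme.{0} := (jY ≫ π).image
  let πt : X ⟶ Xt := (jY ≫ π).toImage
  let ft : Xt ⟶ Spec (.of R) := (jY ≫ π).imageι ≫ pullback.snd P.hom (specOver A₀ R).hom
  have Hmain : IsPullback πt f ft (Spec.map (CommRingCat.ofHom R.val.toRingHom)) := by
    have h := HX.flip.paste_vert Hleg
    rwa [hg] at h
  -- ### Step 3: the finitely generated subfield `K₀ = closure (φ(G) ∪ t) ⊇ A₀[t]`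
  obtain ⟨G, hG⟩ := hfgA.out
  let s : Finset k := G.image φ ∪ i.unop.1
  let K₀ : Subfield k := Subfield.closure (↑s : Set k)
  have hφK : ∀ a : A₀, φ a ∈ K₀ := by
    intro a
    have ha : a ∈ Algebra.adjoin ℤ (G : Set A₀) := by rw [hG]; exact Algebra.mem_top
    rw [Algebra.adjoin_int, mem_subalgebraOfSubring] at ha
    have hφa : φ a ∈ (Subring.closure (G : Set A₀)).map φ := Subring.mem_map.mpr ⟨a, ha, rfl⟩
    rw [RingHom.map_closure] at hφa
    refine (Subring.closure_le.mpr ?_ : Subring.closure (φ '' (G : Set A₀)) ≤ K₀.toSubring) hφa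
    rintro _ ⟨g, hg, rfl⟩
    exact Subfield.subset_closure (Finset.mem_coe.2
      (Finset.mem_union_left _ (Finset.mem_image_of_mem φ (Finset.mem_coe.1 hg))))
  have hRK : ∀ x : k, x ∈ R → x ∈ K₀ := by
    let K₀' : Subalgebra A₀ k :=
      { K₀.toSubring with
        algebraMap_mem' := fun a => hφK a }
    have hle : R ≤ K₀' := Algebra.adjoin_le fun x hx =>
      Subfield.subset_closure (Finset.mem_coe.2 (Finset.mem_union_right _ (Finset.mem_coe.1 hx)))
    exact fun x hx => hle hx
  let ι₀ : R →+* K₀ := R.val.toRingHom.codRestrict K₀ fun x => hRK x.1 x.2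
  have hι₀ : K₀.subtype.comp ι₀ = R.val.toRingHom := RingHom.ext fun _ => rfl
  let g₀ : Spec (.of K₀) ⟶ Spec (.of R) := Spec.map (CommRingCat.ofHom ι₀)
  let g' : Spec (.of k) ⟶ Spec (.of K₀) := Spec.map (CommRingCat.ofHom K₀.subtype)
  have hg' : g' ≫ g₀ = Spec.map (CommRingCat.ofHom R.val.toRingHom) := by
    rw [← Spec.map_comp, ← CommRingCat.ofHom_comp, hι₀]
  -- ### Step 4: the model `X₀ = X_t ×_{A₀[t]} Spec K₀` and `X = X₀ ×_{K₀} Spec k`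
  let f₀ : pullback ft g₀ ⟶ Spec (.of K₀) := pullback.snd ft g₀
  have hw : πt ≫ ft = (f ≫ g') ≫ g₀ := by rw [Category.assoc, hg']; exact Hmain.w
  let c : X ⟶ pullback ft g₀ := pullback.lift πt (f ≫ g') hw
  have hc₁ : c ≫ pullback.fst ft g₀ = πt := pullback.lift_fst _ _ _
  have hc₂ : c ≫ f₀ = f ≫ g' := pullback.lift_snd _ _ _
  have hbig : IsPullback (c ≫ pullback.fst ft g₀) f ft (g' ≫ g₀) := by
    rw [hc₁, hg']; exact Hmain
  have T : IsPullback c f f₀ g' := hbig.of_right hc₂ (IsPullback.of_hasPullback ft g₀)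
  -- ### Step 5: `X → X₀` is flat and surjective, so `X₀` is reduced
  have hflat : Flat g' := by
    change Flat (Spec.map (CommRingCat.ofHom K₀.subtype))
    rw [HasRingHomProperty.Spec_iff (P := @Flat)]
    change (K₀.subtype).Flat
    letI := K₀.subtype.toAlgebra
    change Module.Flat K₀ k
    infer_instance
  have hsurj : Surjective g' := by
    haveI : Subsingleton ↥(Spec (CommRingCat.of K₀)) :=
      inferInstanceAs (Subsingleton (PrimeSpectrum K₀))
    haveI : Nonempty ↥(Spec (CommRingCat.of k)) := inferInstanceAs (Nonempty (PrimeSpectrum k))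
    infer_instance
  haveI : Flat c := MorphismProperty.of_isPullback (P := @Flat) T.flip hflat
  haveI : Surjective c := MorphismProperty.of_isPullback (P := @Surjective) T.flip hsurj
  haveI := hred
  haveI : IsReduced (pullback ft g₀) := isReduced_of_flat_of_surjective c
  exact ⟨K₀, s, rfl, pullback ft g₀, f₀, inferInstance, inferInstance, inferInstance, inferInstance,
    ⟨T.isoPullback⟩⟩

end Summit.ResolutionOfSingularities.ResolutionOfSingularities.Theorems

end
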